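import Literature.AnabelianGeometry.EtaleTheta.LogDivisorModelZTower
import HarnessLib

/-!
# [EtTh] Def. 3.3 (iii) / Rmk. 3.3.1 at the ℤ-tower: the PRIMARY RAYS of `Φ₀(S)` (Galois orbits of components) and the
# dichotomy for pull-backs along endomorphisms — identity, or a primary ray carried off itself (class (b))

S. Mochizuki, *The étale theta function …*, Publ. RIMS **45** (2009) [MochizukiEtTh2009], Def. 3.3 (iii) p.73, Rmk. 3.3.1
p.73–74 («the set of primes of `Div⁺(Z^log_∞)^{Gal(Z^log_∞/Y^log)}` … is in natural bijective correspondence with the set of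
`Gal(Z^log_∞/Y^log)`-orbits of prime log-divisors on `Z^log_∞`») [cite: MochizukiEtTh2009, Rmk 3.3.1 p.73]; [FrdI] §0 p.12
(`≼`, primary elements), Def. 1.1 (i) p.19 (non-dilating endomorphisms).

abc-iut cell, layer L2 [EtTh], seat abc-iut-w5-d179 (gen 6), L2-lead row R505 sequel «Thm44Hyp at EVERY character».  For the
ℤ-tower datum `ZTower.action φ` (p460567: a group `Γ` translating the chain of components of the Tate tower skeleton through
`φ : Γ →* ℤ`) and a `Γ`-set `S` with base point `s₀`:
* `ZTower.InRay φ S s₀ s n` — «the prime log-divisor `(s, F_n)` lies in the `Γ`-orbit of `(s₀, F_0)`»: `∃ h, h·s₀ = s ∧ φ h = n`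
  (so at `s₀` itself: `n ∈ φ(Stab s₀)`); `inRay_ρ_iff` (translation law);
* **`ZTower.ray φ S s₀ ∈ Φ₀(S)`** — the indicator of that orbit: the reduced sum of the prime log-divisors in the orbit of
  `(s₀, F_0)`, i.e. ONE PRIME of `Φ₀(S)` in the sense of Rmk. 3.3.1; coordinates `coord_ray_of_inRay` / `coord_ray_of_not_inRay`;
* **`isPrimary_ray`** — the ray is a PRIMARY element of the monoid `Φ₀(S)` ([FrdI] §0): an element `b ≼ ray` is supported on
  the orbit, and elements of `Φ₀(S)` are CONSTANT on orbits (`coord_eq_coord_base_of_inRay`, equivariance + periodicity), so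
  `b = ray^c` (`eq_ray_pow_of_precsim_ray`);
* **`phiZeroPull_dichotomy`** — for `S` connected and ANY endomorphism `f : S → S` (`f s₀ = g₀·s₀`): EITHER `φ g₀ ∈ φ(Stab s₀)`
  and the pull-back `Φ₀(f)` is the IDENTITY of `Φ₀(S)`, OR the primary ray is carried off itself: `¬ (Φ₀(f)(ray) ≼ ray)` —
  the translation by `φ g₀` moves the orbit of `(s₀, F_0)` to that of `(s₀, F_{φ g₀})`.  This is the input of [FrdI]
  Def. 1.1 (i) «non-dilating» for the tempered Frobenioid of the ℤ-tower along EVERY endomorphism (sequel file).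
Class (b): 3 defs (`InRay`, `rayDIV`, `ray`) + theorems; no Prop-valued fact, no instance, no notation, no sorry.  HONEST FRAMING:
combinatorial model (divisor/Galois skeleton of the Tate tower); nothing here bears on [IUTchIII] Cor. 3.12; typed ≠ proved.
-/

noncomputable section

namespace Literature.AnabelianGeometry.EtaleTheta

open CategoryTheory Literature.AlgebraicGeometry.Frobenioids

namespace LogDivisorModel.ZTower

open TateTower GaloisAction

variable {Γ : Type} [Group Γ] (φ : Γ →* Multiplicative ℤ) (S : Action (Type 0) Γ)

/-! ### Plumbing: the action of `Γ` on the points of `S` -/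

/-- `1` acts trivially. [folklore] -/
private theorem ρ_one_apply (s : S.V) : S.ρ 1 s = s := by
  rw [map_one]
  rfl

/-- `(g h)·s = g·(h·s)`. [folklore] -/
private theorem ρ_mul_apply (g h : Γ) (s : S.V) : S.ρ (g * h) s = S.ρ g (S.ρ h s) := by
  rw [map_mul]
  rfl

/-- Morphisms of `Γ`-sets are equivariant, pointwise. [folklore] -/
private theorem hom_ρ_apply {S' : Action (Type 0) Γ} (f : S ⟶ S') (g : Γ) (s : S.V) : f.hom (S.ρ g s) = S'.ρ g (f.hom s) := by
  have h := f.comm g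
  exact congrFun (congrArg (fun ψ : S.V ⟶ S'.V => (ψ : S.V → S'.V)) h) s

/-! ### The orbit of the prime log-divisor `(s₀, F_0)` -/

/-- **`InRay s₀ s n`**: the prime log-divisor `(s, F_n)` lies in the `Γ`-orbit of `(s₀, F_0)` — some `h` carries `s₀` to `s`
and translates the chain by `n`. [cite: MochizukiEtTh2009, Rmk 3.3.1 p.73] -/
def InRay (s₀ s : S.V) (n : ℤ) : Prop := ∃ h : Γ, S.ρ h s₀ = s ∧ φ h = Multiplicative.ofAdd n

/-- `(s₀, F_0)` lies in its own orbit. [cite: MochizukiEtTh2009, Rmk 3.3.1 p.73] -/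
theorem inRay_self (s₀ : S.V) : InRay φ S s₀ s₀ 0 := ⟨1, ρ_one_apply S s₀, by rw [map_one, ofAdd_zero]⟩

/-- `(g·s₀, F_{φ g})` lies in the orbit of `(s₀, F_0)`. [cite: MochizukiEtTh2009, Rmk 3.3.1 p.73] -/
theorem inRay_ρ_self (s₀ : S.V) (g : Γ) : InRay φ S s₀ (S.ρ g s₀) (Multiplicative.toAdd (φ g)) := ⟨g, rfl, (ofAdd_toAdd _).symm⟩

/-- **Translation law**: `(g·s, F_n)` is in the orbit iff `(s, F_{n − φ g})` is. [cite: MochizukiEtTh2009, Rmk 3.3.1 p.73] -/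
theorem inRay_ρ_iff (s₀ s : S.V) (g : Γ) (n : ℤ) :
    InRay φ S s₀ (S.ρ g s) n ↔ InRay φ S s₀ s (n - Multiplicative.toAdd (φ g)) := by
  constructor
  · rintro ⟨h, hs, hn⟩
    refine ⟨g⁻¹ * h, ?_, ?_⟩
    · rw [ρ_mul_apply, hs, ← ρ_mul_apply, inv_mul_cancel, ρ_one_apply]
    · apply Multiplicative.toAdd.injective
      rw [map_mul, map_inv, hn, toAdd_mul, toAdd_inv, toAdd_ofAdd, toAdd_ofAdd, neg_add_eq_sub]
  · rintro ⟨h, hs, hn⟩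
    refine ⟨g * h, ?_, ?_⟩
    · rw [ρ_mul_apply, hs]
    · apply Multiplicative.toAdd.injective
      rw [map_mul, hn, toAdd_mul, toAdd_ofAdd, toAdd_ofAdd, add_sub_cancel]

/-! ### The ray: the reduced orbit of `(s₀, F_0)` as an element of `Φ₀(S)` -/

open Classical in
/-- The log-divisor on the chain over the point `s` supported, with multiplicity one, on the components in the orbit of
`(s₀, F_0)`. [cite: MochizukiEtTh2009, Rmk 3.3.1 p.73] -/
def rayDIV (s₀ s : S.V) : model.DIV :=
  Multiplicative.ofAdd (α := TateTower.Idx → ℤ) (Sum.elim PEmpty.elim fun n => if InRay φ S s₀ s n then 1 else 0)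

open Classical in
/-- Multiplicities of `rayDIV`. [cite: MochizukiEtTh2009, Rmk 3.3.1 p.73] -/
theorem mlt_rayDIV (s₀ s : S.V) (n : ℤ) : mlt (rayDIV φ S s₀ s) (Sum.inr n) = if InRay φ S s₀ s n then 1 else 0 := rfl

/-- Multiplicity `1` on the orbit. [cite: MochizukiEtTh2009, Rmk 3.3.1 p.73] -/
theorem mlt_rayDIV_of_inRay {s₀ s : S.V} {n : ℤ} (h : InRay φ S s₀ s n) : mlt (rayDIV φ S s₀ s) (Sum.inr n) = 1 := by
  rw [mlt_rayDIV, if_pos h]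

/-- Multiplicity `0` off the orbit. [cite: MochizukiEtTh2009, Rmk 3.3.1 p.73] -/
theorem mlt_rayDIV_of_not_inRay {s₀ s : S.V} {n : ℤ} (h : ¬ InRay φ S s₀ s n) : mlt (rayDIV φ S s₀ s) (Sum.inr n) = 0 := by
  rw [mlt_rayDIV, if_neg h]

/-- `rayDIV` is effective (and Cartier). [cite: MochizukiEtTh2009, Def 3.1 p.70] -/
theorem rayDIV_mem_Divplus (s₀ s : S.V) : rayDIV φ S s₀ s ∈ model.Divplus :=
  mem_Divplus_of_nonneg fun x => by
    rcases x with c | n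
    · exact c.elim
    · by_cases h : InRay φ S s₀ s n
      · rw [mlt_rayDIV_of_inRay φ S h]; exact zero_le_one
      · rw [mlt_rayDIV_of_not_inRay φ S h]

/-- `rayDIV` is equivariant: `rayDIV (g·s) = g·(rayDIV s)` (translation law of the orbit). [cite: MochizukiEtTh2009, Def 3.3 p.73] -/
theorem rayDIV_ρ (s₀ s : S.V) (g : Γ) : rayDIV φ S s₀ (S.ρ g s) = (action φ).actDIV g (rayDIV φ S s₀ s) :=
  ext_mlt fun x => by
    rcases x with c | n
    · exact c.elim
    · rw [mlt_actDIV_inr]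
      by_cases h : InRay φ S s₀ s (n - Multiplicative.toAdd (φ g))
      · rw [mlt_rayDIV_of_inRay φ S ((inRay_ρ_iff φ S s₀ s g n).2 h), mlt_rayDIV_of_inRay φ S h]
      · rw [mlt_rayDIV_of_not_inRay φ S (fun h' => h ((inRay_ρ_iff φ S s₀ s g n).1 h')), mlt_rayDIV_of_not_inRay φ S h]

/-- **The ray `e_{(s₀, F_0)} ∈ Φ₀(S)`**: the reduced `Γ`-orbit of the prime log-divisor `(s₀, F_0)` — ONE prime of `Φ₀(S)`
(Rmk. 3.3.1). [cite: MochizukiEtTh2009, Rmk 3.3.1 p.73] -/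
def ray (s₀ : S.V) : (action φ).phiZero S :=
  ⟨fun s => rayDIV φ S s₀ s, fun s => rayDIV_mem_Divplus φ S s₀ s, fun g s => rayDIV_ρ φ S s₀ s g⟩

/-- The ray, evaluated. [cite: MochizukiEtTh2009, Rmk 3.3.1 p.73] -/
@[simp] theorem ray_apply (s₀ s : S.V) : (ray φ S s₀).1 s = rayDIV φ S s₀ s := rfl

/-- Coordinate `1` (i.e. `ofAdd 1`) on the orbit. [cite: MochizukiEtTh2009, Rmk 3.3.1 p.73] -/
theorem coord_ray_of_inRay {s₀ s : S.V} {n : ℤ} (h : InRay φ S s₀ s n) : coord φ S s n (ray φ S s₀) = Multiplicative.ofAdd 1 := by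
  rw [coord_apply, ray_apply, mlt_rayDIV_of_inRay φ S h]
  rfl

/-- Coordinate `0` (i.e. `1`) off the orbit. [cite: MochizukiEtTh2009, Rmk 3.3.1 p.73] -/
theorem coord_ray_of_not_inRay {s₀ s : S.V} {n : ℤ} (h : ¬ InRay φ S s₀ s n) : coord φ S s n (ray φ S s₀) = 1 := by
  rw [coord_apply, ray_apply, mlt_rayDIV_of_not_inRay φ S h, Int.toNat_zero, ofAdd_zero]

/-- The ray is not trivial. [cite: MochizukiEtTh2009, Rmk 3.3.1 p.73] -/
theorem ray_ne_one (s₀ : S.V) : ray φ S s₀ ≠ 1 := fun h => by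
  have h1 : coord φ S s₀ 0 (ray φ S s₀) = 1 := by rw [h, map_one]
  rw [coord_ray_of_inRay φ S (inRay_self φ S s₀)] at h1
  exact one_ne_zero (ofAdd_eq_one.mp h1)

/-! ### Elements of `Φ₀(S)` are constant on orbits; the ray is primary -/

/-- **Elements of `Φ₀(S)` are constant on the orbit of `(s₀, F_0)`** (equivariance + periodicity under `Stab s₀`).
[cite: MochizukiEtTh2009, Rmk 3.3.1 p.73] -/
theorem coord_eq_coord_base_of_inRay (ψ : (action φ).phiZero S) {s₀ s : S.V} {n : ℤ} (h : InRay φ S s₀ s n) :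
    coord φ S s n ψ = coord φ S s₀ 0 ψ := by
  obtain ⟨g, rfl, hg⟩ := h
  rw [coord_ρ, hg, toAdd_ofAdd, sub_self]

/-- The coordinate of a power is the power of the coordinate, additively. [cite: MochizukiEtTh2009, Def 3.1 p.70] -/
theorem coord_pow (s : S.V) (n : ℤ) (ψ : (action φ).phiZero S) (k : ℕ) :
    coord φ S s n (ψ ^ k) = Multiplicative.ofAdd (k * Multiplicative.toAdd (coord φ S s n ψ)) := by
  apply Multiplicative.toAdd.injective
  rw [map_pow, toAdd_pow, toAdd_ofAdd, smul_eq_mul]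

/-- An element `b ≼ ray` (i.e. `b ∣ ray^k`, `k ≥ 1`) VANISHES off the orbit. [cite: MochizukiFrdI2008, §0 p.12] -/
theorem coord_eq_one_of_precsim_ray {s₀ : S.V} {b : (action φ).phiZero S} (hb : Precsim b (ray φ S s₀)) {s : S.V} {n : ℤ}
    (h : ¬ InRay φ S s₀ s n) : coord φ S s n b = 1 := by
  obtain ⟨k, -, c, hc⟩ := hb
  have h1 : coord φ S s n (ray φ S s₀ ^ k) = coord φ S s n (b * c) := congrArg (fun ψ => coord φ S s n ψ) hc
  rw [map_pow, coord_ray_of_not_inRay φ S h, one_pow, map_mul] at h1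
  exact (mul_eq_one.mp h1.symm).1

/-- **An element `b ≼ ray` is a power of the ray**: `b = ray^c` with `c` its coordinate at `(s₀, F_0)`.
[cite: MochizukiFrdI2008, §0 p.12] -/
theorem eq_ray_pow_of_precsim_ray {s₀ : S.V} {b : (action φ).phiZero S} (hb : Precsim b (ray φ S s₀)) :
    b = ray φ S s₀ ^ Multiplicative.toAdd (coord φ S s₀ 0 b) :=
  coord_separating φ S fun s n => by
    by_cases h : InRay φ S s₀ s n
    · rw [coord_eq_coord_base_of_inRay φ S b h, coord_pow, coord_ray_of_inRay φ S h, toAdd_ofAdd, mul_one, ofAdd_toAdd]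
    · rw [coord_eq_one_of_precsim_ray φ S hb h, map_pow, coord_ray_of_not_inRay φ S h, one_pow]

/-- **The ray is a PRIMARY element of `Φ₀(S)`** ([FrdI] §0: `≠ 1`, and `ray ≼ b` for every non-trivial `b ≼ ray`).
[cite: MochizukiFrdI2008, §0 p.12] -/
theorem isPrimary_ray (s₀ : S.V) : IsPrimary (ray φ S s₀) := by
  refine ⟨ray_ne_one φ S s₀, fun b hb hba => ?_⟩
  have e := eq_ray_pow_of_precsim_ray φ S hba
  have hc : Multiplicative.toAdd (coord φ S s₀ 0 b) ≠ 0 := fun h0 => hb (by rw [e, h0, pow_zero])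
  exact ⟨1, one_pos, by rw [pow_one, e]; exact dvd_pow_self _ hc⟩

/-! ### Pull-backs along endomorphisms: the dichotomy -/

/-- Coordinates of a pull-back: `coord (s, n) (Φ₀(f) ψ) = coord (f s, n) ψ`. [cite: MochizukiEtTh2009, Def 3.3 p.73] -/
theorem coord_phiZeroPull {S' : Action (Type 0) Γ} (f : S ⟶ S') (s : S.V) (n : ℤ) (ψ : (action φ).phiZero S') :
    coord φ S s n ((action φ).phiZeroPull f ψ) = coord φ S' (f.hom s) n ψ := rfl

/-- Elements acting through the same value of `φ` act identically on log-divisors. [cite: MochizukiEtTh2009, Def 3.3 p.73] -/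
theorem actDIV_eq_of_apply_eq {g h : Γ} (hgh : φ g = φ h) (d : model.DIV) : (action φ).actDIV g d = (action φ).actDIV h d :=
  ext_mlt fun x => by rw [mlt_actDIV, mlt_actDIV, hgh]

variable {S}

/-- **Periodicity**: if some `h ∈ Stab s₀` has `φ h = φ g₀`, then translating the profile at `s₀` by `φ g₀` changes nothing:
`ψ(g₀·s₀) = ψ(s₀)`. [cite: MochizukiEtTh2009, Rmk 3.3.1 p.73] -/
theorem apply_ρ_eq_of_inRay (ψ : (action φ).phiZero S) {s₀ : S.V} {g₀ : Γ}
    (h : InRay φ S s₀ s₀ (Multiplicative.toAdd (φ g₀))) : ψ.1 (S.ρ g₀ s₀) = ψ.1 s₀ := by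
  obtain ⟨k, hk, hφk⟩ := h
  rw [ofAdd_toAdd] at hφk
  rw [ψ.2.2 g₀ s₀, ← actDIV_eq_of_apply_eq φ hφk, ← ψ.2.2 k s₀, hk]

/-- **THE DICHOTOMY.** For a connected `S` and any endomorphism `f` (`f s₀ = g₀·s₀`): either `φ g₀ ∈ φ(Stab s₀)` and `Φ₀(f)` is
the identity of `Φ₀(S)`, or the primary ray `e_{(s₀, F_0)}` is carried off itself, `¬ (Φ₀(f)(e) ≼ e)` — so every dilation
hypothesis of [FrdI] Def. 1.1 (i) along `f` fails unless `Φ₀(f) = id`. [cite: MochizukiFrdI2008, Def. 1.1 (i) p.19] -/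
theorem phiZeroPull_dichotomy (hS : isConnectedGSet S) (f : S ⟶ S) :
    (∀ ψ : (action φ).phiZero S, (action φ).phiZeroPull f ψ = ψ) ∨
      ∃ p : (action φ).phiZero S, IsPrimary p ∧ ¬ Precsim ((action φ).phiZeroPull f p) p := by
  obtain ⟨⟨s₀⟩, htrans⟩ := (isConnectedGSet_iff S).1 hS
  obtain ⟨g₀, hg₀⟩ := htrans s₀ (f.hom s₀)
  by_cases hper : InRay φ S s₀ s₀ (Multiplicative.toAdd (φ g₀))
  · refine Or.inl fun ψ => Subtype.ext (funext fun s => ?_)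
    obtain ⟨g, rfl⟩ := htrans s₀ s
    rw [phiZeroPull_apply, hom_ρ_apply S f g s₀, ← hg₀, ψ.2.2 g (S.ρ g₀ s₀), apply_ρ_eq_of_inRay φ ψ hper, ← ψ.2.2 g s₀]
  · refine Or.inr ⟨ray φ S s₀, isPrimary_ray φ S s₀, fun hprec => ?_⟩
    have h0 := coord_eq_one_of_precsim_ray φ S hprec hper
    rw [coord_phiZeroPull, ← hg₀, coord_ray_of_inRay φ S (inRay_ρ_self φ S s₀ g₀)] at h0
    exact one_ne_zero (ofAdd_eq_one.mp h0)

/-- The same dichotomy with `Φ₀(f)` read as the functor `PhiZero` on the morphism `f`. [cite: MochizukiFrdI2008, Def. 1.1 (i) p.19] -/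
theorem PhiZero_map_dichotomy (hS : isConnectedGSet S) (f : S ⟶ S) :
    (∀ ψ : (action φ).phiZero S, ((action φ).PhiZero.map f.op).hom ψ = ψ) ∨
      ∃ p : (action φ).phiZero S, IsPrimary p ∧ ¬ Precsim (((action φ).PhiZero.map f.op).hom p) p :=
  phiZeroPull_dichotomy φ hS f

end LogDivisorModel.ZTower

end Literature.AnabelianGeometry.EtaleTheta

end
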